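import Summits.Ventures.HSemireg.WedgeHankelSecantPointKernel
import Summits.Ventures.HSemireg.WedgeHankelTwoNodesShear

/-!
# Venture HSemireg — BRIDGE between gen 13/14's FRAME IDEALS and gen 15's LETTER-COUNT spaces: `F_0(k) = xRich(k,0)`, `F_∞(k) = yRich(k,0)`,
# `F_λ(k) = Φs λ (xRich(k,0))`, `F_λ(k) ∩ F_∞(k) = Φs λ (xyRich(k,0,0))` — the «recovered by value» remarks of E3/E4/E5/E9 as equalities

HONEST FRAMING. Part of the Lean index of the computation cell `pub-hsemireg` (seat p10 gen 15, Sunday typer «UNIFORM-IN-n»).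
Finite-dimensional EXTERIOR ALGEBRA over a field ONLY: no variety, no cohomology theory, no sheaf, no Ext group, no semiregularity map;
nothing here says that HC / HC_CM / HC_AV holds; no Literature fact is declared or used.  Custodian versions as in `WedgeHankelSiegelIdeal` (1/3);
the dictionary is QUOTED, never asserted.

WHAT IS KEYED.  Gen 13 C6/C7 (`WedgeHankelPureKernel`, `WedgeHankelPointKernel`, rows 732/740): the kernel of the pure class `A·exp(λΘ)` is the frame ideal
`F_λ(k) = Σ_a (x_a + λ y_a) ∧ Hom(univ, k−1)` (`Kr_w_expSeq`), of the point it is `F_∞(k) = Σ_a y_a ∧ Hom(univ, k−1)` (`Kr_w_point`); gen 14 D5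
(`WedgeHankelSecantPointKernel`, 766): `A·exp(λΘ) + c·pt` has kernel `F_λ(k) ∩ F_∞(k)` (`Kr_w_exp_add_point`).  Gen 15 (E3/E4/E5/E9) names the same kernels
as the order-`0` cases of the confluent laws: `xRich(k,0)`, `yRich(k,0)`, `Φs λ (xRich(k,0))`, `Φs λ (xyRich(k,0,0))`.  THIS FILE (namespace
`Summit.Ventures.HSemireg.Wedge.HankelFrameChange` continued; imports D5 (hence C6, C7) and E9 (hence E3–E5, E8)) equates the two vocabularies by comparing
kernels of the same class — no new mathematics, four identities:
* `xRich_zero_eq_frameIdeal`: `xRich(k, 0) = F_0(k)` (`1 ≤ k ≤ n`); `map_Φs_xRich_zero_eq_frameIdeal`: `Φs λ (xRich(k,0)) = F_λ(k)`;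
  `yRich_zero_eq_frameIdeal_Y`: `yRich(k,0) = F_∞(k)`; `map_Φs_xyRich_zero_eq`: `Φs λ (xyRich(k,0,0)) = F_λ(k) ∩ F_∞(k)` (`1 ≤ k ≤ n − 1`).
So every frame-ideal statement of gens 13/14 is the order-`0` face of the gen-15 laws, and the gen-15 laws extend them to every order.  Class side only.
-/

open Module

namespace Summit.Ventures.HSemireg.Wedge.HankelFrameChange

open Summit.Ventures.HSemireg.Wedge Summit.Ventures.HSemireg.Wedge.Kunneth Summit.Ventures.HSemireg.Wedge.Hankel
  Summit.Ventures.HSemireg.Wedge.HankelSiegelIdeal Summit.Ventures.HSemireg.Wedge.KunnethKernel Summit.Ventures.HSemireg.Wedge.HankelFaces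
  Summit.Ventures.HSemireg.Wedge.HankelBox Summit.Ventures.HSemireg.Wedge.HankelPureKernel Summit.Ventures.HSemireg.Wedge.HankelSecant

variable (K : Type*) [Field K] {n : ℕ}

/-- the exponential sequence at slope `0` is `A·δ_0`. -/
lemma expSeq_zero (A : K) : expSeq K A 0 = fun j => if j = 0 then A else 0 := by
  funext j; rw [expSeq_apply]; cases j with
  | zero => rw [pow_zero, mul_one, if_pos rfl]
  | succ j => rw [zero_pow (Nat.succ_ne_zero j), mul_zero, if_neg (Nat.succ_ne_zero j)]

/-- **`xRich(k, 0) = F_0(k)`**: the forms with an `x`-letter are the degree-`k` part of the ideal of the frame `{x_a}` (`1 ≤ k ≤ n`). -/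
theorem xRich_zero_eq_frameIdeal {k : ℕ} (hk : 1 ≤ k) (hkn : k ≤ n) : xRich K n k 0 = frameIdeal K n (uvec K n 0) k := by
  rw [← Kr_w_pure_zero K hkn (A := 1) one_ne_zero, ← expSeq_zero, Kr_w_expSeq K n one_ne_zero 0 hk]

/-- **`Φs λ (xRich(k, 0)) = F_λ(k)`**: the frame change carries the `x`-ideal to the ideal of the frame `{x_a + λ y_a}` (`1 ≤ k ≤ n`). -/
theorem map_Φs_xRich_zero_eq_frameIdeal (lam : K) {k : ℕ} (hk : 1 ≤ k) (hkn : k ≤ n) :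
    (xRich K n k 0).map (Φs K (n := n) lam).toLinearMap = frameIdeal K n (uvec K n lam) k := by
  rw [← Kr_w_exp_eq K hkn lam (A := 1) one_ne_zero, show (fun j => (1 : K) * lam ^ j) = expSeq K 1 lam from rfl,
    Kr_w_expSeq K n one_ne_zero lam hk]

/-- the point sequence of `WedgeHankelBox` with zero head is the spike `c·δ_n`. -/
lemma ppSeq_zero_eq (c : K) : ppSeq K n 0 c = fun j => if j = n then c else 0 := by
  funext j; rw [ppSeq_apply]; split_ifs <;> simp

/-- **`yRich(k, 0) = F_∞(k)`**: the forms with a `y`-letter are the degree-`k` part of the ideal of the frame `{y_a}` (`1 ≤ k ≤ n`). -/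
theorem yRich_zero_eq_frameIdeal_Y {k : ℕ} (hk : 1 ≤ k) (hkn : k ≤ n) : yRich K n k 0 = frameIdeal K n (Y K n) k := by
  rw [← Kr_w_point_eq_yRich K hkn (c := 1) one_ne_zero, ← ppSeq_zero_eq, Kr_w_point K n (by omega) one_ne_zero hk]

/-- **`Φs λ (xyRich(k, 0, 0)) = F_λ(k) ∩ F_∞(k)`** (`1 ≤ k ≤ n − 1`): «an x-letter from the λ-frame and a y-letter» = the intersection of the two frame ideals. -/
theorem map_Φs_xyRich_zero_eq (lam : K) {k : ℕ} (hk : 1 ≤ k) (hkn : k + 1 ≤ n) :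
    (xyRich K n k 0 0).map (Φs K (n := n) lam).toLinearMap = frameIdeal K n (uvec K n lam) k ⊓ frameIdeal K n (Y K n) k := by
  rw [← Kr_w_exp_add_point' K lam hkn (A := 1) (c := 1) one_ne_zero one_ne_zero,
    ← Kr_w_exp_add_point K n hk hkn one_ne_zero lam one_ne_zero]
  congr 3
  funext j
  simp only [Pi.add_apply, expSeq_apply, ppSeq_apply, one_mul]
  split_ifs <;> simp

end Summit.Ventures.HSemireg.Wedge.HankelFrameChange
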